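import Mathlib
import Summits.PneNP.PneNP.Theorems.ChebyshevTracialDesignJuntaPatternLaw
import Summits.PneNP.PneNP.Theorems.ChebyshevTracialDesignHalfDegreeAtoms
import Summits.PneNP.PneNP.Theorems.ChebyshevTracialDesignHalfDegreeWindow
import HarnessLib

/-!
# Half-degree lemma, part C: level sums of a monomial against a perfect matching

Support file for the crux `TracialDecayExp20` (stmt-PneNP-19878) of route `ChebyshevTracialDesign`
(cell pnp-psdrank; prover R1-SKELETON S3(ii) «deg_c σ_k ≤ k/2»; p1 ROUND-2 §2(v) HALF-DEGREE LEMMA, there proved by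
an exp/log power-series argument — here by the finite atom recursion of part A
(`ChebyshevTracialDesignHalfDegreeAtoms`) and the trace/placement bijection of part B
(`ChebyshevTracialDesignHalfDegreeWindow`)).

Summing the fibre counts of the junta files (`card_fiber_eq`, `T_ratio_nat`) over the traces of the window gives
`Σ_{U : #cr(U,M) = c, #in(U,M) = i} 1[A ⊆ U] = T(|M|;c,i) · H_E(c) / [|M|]_{|E|}` with `H_E` the placement
polynomial (atoms = window edges, `κ_e ∈ {1/2, 0}`, weights `w_e = |A ∩ e|`, `Σ_e w_e = |A|`), whose degree is
`≤ ⌊|A|/2⌋`: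

* `half_degree_monomial`: `∃ P, natDegree P ≤ |A|/2 ∧ ∀ c i, c + 2i = t → Σ_{U : #cr = c, #in = i} 1[A ⊆ U] =
  T(|M|;c,i)·P(c)` — the conditional probability `P[A ⊆ U | cc(U,M) = c]` on `t`-sets is a polynomial in the
  level `c` of degree at most HALF the x-degree of the monomial `x_A`;
* `half_degree`: the same for any combination `f = Σ_{|A| ≤ K} α_A x_A` of monomials of x-degree `≤ K`
  (`natDegree ≤ K/2`) — the form consumed by the (L2) tail estimate of the r = 1 rung
  (HOME/pnp-psdrank-p1/N2-SpreadStructure.md, LINE CPD): an exact design of degree `D` prices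
  `p(c)·E[f | cc = c]` at the virtual level `c = 0` whenever `deg p + K/2 ≤ D`.

WHAT THIS IS NOT: no statement about psd strategies or psd rank; support/instrument for stmt-PneNP-19878 only.
No definitions.
-/

set_option linter.dupNamespace false -- `Summit.PneNP.PneNP.…`: summit = sub-problem (D-0017)

namespace Summit.PneNP.PneNP.Theorems.ChebyshevTracialDesignHalfDegree

open Finset Polynomial

/-! ## Part C — the half-degree lemma -/

section HalfDegree

open Literature.Barriers.PneNP Summit.PneNP.PneNP.Theorems.ChebyshevTracialDesignJunta

variable {V : Type*} [DecidableEq V]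

/-- The fibre count over a trace `B ⊇ A` as a multiple of the level-class size:
`T(N−x; c−y, i−z) = T(N;c,i)·[c]_y·[i]_z / (2^y·[N]_x)` when `y + z = x ≤ N` (both sides vanish in the
degenerate ranges `y > c`, `z > i`, `c + i > N`). [folklore] -/
theorem fibre_ratio {N x y z : ℕ} (hx : x ≤ N) (hyz : y + z = x) (c i : ℕ) :
    (((if y ≤ c ∧ z ≤ i then
        (N - x).choose (c - y + (i - z)) * (c - y + (i - z)).choose (i - z) * 2 ^ (c - y) else 0 : ℕ)) : ℝ) =
      ((N.choose (c + i) * (c + i).choose i * 2 ^ c : ℕ) : ℝ) *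
        ((∏ j ∈ range y, ((c : ℝ) - j)) * (∏ j ∈ range z, ((i : ℝ) - j)) /
          ((2 : ℝ) ^ y * (N.descFactorial x : ℝ))) := by
  have hNx : (0 : ℝ) < N.descFactorial x := by
    have : N.descFactorial x ≠ 0 := fun h0 => by rw [Nat.descFactorial_eq_zero_iff_lt] at h0; omega
    positivity
  have h2y : (0 : ℝ) < (2 : ℝ) ^ y * (N.descFactorial x : ℝ) := by positivity
  by_cases hyc : y ≤ c
  · by_cases hzi : z ≤ i
    · rw [if_pos ⟨hyc, hzi⟩]
      by_cases hciN : c + i ≤ N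
      · have he : x - y - z ≤ N - c - i := by omega
        have key := T_ratio_nat hx hyz.le hyc hzi hciN he
        have keyR : (((N - x).choose (c - y + (i - z)) * (c - y + (i - z)).choose (i - z) * 2 ^ (c - y) : ℕ) : ℝ) *
            ((2 : ℝ) ^ y * (N.descFactorial x : ℝ)) =
            ((N.choose (c + i) * (c + i).choose i * 2 ^ c : ℕ) : ℝ) *
              ((c.descFactorial y : ℝ) * (i.descFactorial z : ℝ) * ((N - c - i).descFactorial (x - y - z) : ℝ)) := by
          exact_mod_cast key
        have hxyz : x - y - z = 0 := by omega
        rw [hxyz, Nat.descFactorial_zero, Nat.cast_one, mul_one, cast_descFactorial_eq_prod hyc,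
          cast_descFactorial_eq_prod hzi] at keyR
        rw [mul_div_assoc', eq_div_iff h2y.ne']
        linear_combination keyR
      · have hL : N - x < c - y + (i - z) := by omega
        rw [Nat.choose_eq_zero_of_lt hL, Nat.choose_eq_zero_of_lt (not_le.1 hciN)]
        simp
    · rw [if_neg (fun h => hzi h.2)]
      have h0 : ∏ j ∈ range z, ((i : ℝ) - j) = 0 := prod_eq_zero (mem_range.2 (not_le.1 hzi)) (by simp)
      rw [h0]; simp
  · rw [if_neg (fun h => hyc h.1)]
    have h0 : ∏ j ∈ range y, ((c : ℝ) - j) = 0 := prod_eq_zero (mem_range.2 (not_le.1 hyc)) (by simp)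
    rw [h0]; simp

/-- **Half-degree lemma (level sums of a monomial against a perfect matching)** (cell pnp-psdrank,
p1 ROUND-2 §2(v); prover R1-SKELETON S3(ii) «deg_c σ_k ≤ k/2»): for a perfect matching `M` of `S` and a vertex
set `A ⊆ S` there is a real polynomial `P` with `natDegree P ≤ |A|/2` such that along every line `c + 2i = t`
`Σ_{U ⊆ S : #cr(U,M) = c, #in(U,M) = i} 1[A ⊆ U] = T(|M|; c, i) · P(c)`,
i.e. the conditional probability `P[A ⊆ U | |U| = t, cc(U,M) = c]` is a polynomial in the crossing level `c`
of degree at most HALF the x-degree `|A|` of the monomial `x_A = ∏_{a∈A} 1[a ∈ U]` (`T(N;c,i) =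
C(N,c+i)·C(c+i,i)·2^c` is the size of the level class, junta files part A). Explicitly
`P = H_E(X)/[|M|]_{|E|}` with `H_E` the placement polynomial of `ChebyshevTracialDesignHalfDegreeAtoms` on the
window `E = {e ∈ M : e ∩ A ≠ ∅}`, `κ_e = 1/2` or `0` according as `|A ∩ e| = 1` or `2`. [folklore] -/
theorem half_degree_monomial {S A : Finset V} {M : Finset (Sym2 V)} (hM : IsPMOn S M) (hA : A ⊆ S) (t : ℕ) :
    ∃ P : Polynomial ℝ, P.natDegree ≤ A.card / 2 ∧ ∀ c i : ℕ, c + 2 * i = t →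
      ∑ U ∈ S.powerset.filter (fun U => (M.filter fun e => cutCount U e = 1).card = c ∧
          (M.filter fun e => cutCount U e = 2).card = i), (if A ⊆ U then (1 : ℝ) else 0) =
        ((M.card.choose (c + i) * (c + i).choose i * 2 ^ c : ℕ) : ℝ) * P.eval (c : ℝ) := by
  classical
  have hEM : (M.filter fun e => cutCount A e ≠ 0) ⊆ M := filter_subset _ _
  have hxN : (M.filter fun e => cutCount A e ≠ 0).card ≤ M.card := card_le_card hEM
  have hAW := subset_window hM hA
  refine ⟨C ((M.card.descFactorial (M.filter fun e => cutCount A e ≠ 0).card : ℝ)⁻¹) *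
      ∑ Q ∈ (M.filter fun e => cutCount A e ≠ 0).powerset,
        C (∏ e ∈ (M.filter fun e => cutCount A e ≠ 0) \ Q, (if cutCount A e = 1 then (1 / 2 : ℝ) else 0)) *
        ((∏ j ∈ range ((M.filter fun e => cutCount A e ≠ 0) \ Q).card, (X - C ((j : ℕ) : ℝ))) *
          ∏ j ∈ range Q.card, (C ((t : ℝ) / 2 - ((j : ℕ) : ℝ)) - C (1 / 2 : ℝ) * X)), ?_, ?_⟩
  · -- degree: part A with weights `w e = |A ∩ e|`, `Σ_E w = |A|`
    refine (natDegree_C_mul_le _ _).trans ((natDegree_placement_le (t : ℝ) _ _ (fun e => cutCount A e)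
      (fun e he => Nat.one_le_iff_ne_zero.2 (mem_filter.1 he).2) (fun e _ h1 => if_pos h1)).trans (le_of_eq ?_))
    rw [sum_filter_ne_zero, ← hM.card_eq_sum_cutCount hA]
  · intro c i hci
    -- fibre over the traces on the window's vertex set `W`
    rw [← sum_fiberwise_of_maps_to (g := fun U => U ∩ S.filter fun v =>
        ∃ e ∈ M.filter (fun e => cutCount A e ≠ 0), v ∈ e)
      (t := (S.filter fun v => ∃ e ∈ M.filter (fun e => cutCount A e ≠ 0), v ∈ e).powerset)
      (fun U _ => mem_powerset.2 inter_subset_right)]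
    have hfib : ∀ B ∈ (S.filter fun v => ∃ e ∈ M.filter (fun e => cutCount A e ≠ 0), v ∈ e).powerset,
        ∑ U ∈ (S.powerset.filter fun U => (M.filter fun e => cutCount U e = 1).card = c ∧
            (M.filter fun e => cutCount U e = 2).card = i).filter
            (fun U => U ∩ (S.filter fun v => ∃ e ∈ M.filter (fun e => cutCount A e ≠ 0), v ∈ e) = B),
          (if A ⊆ U then (1 : ℝ) else 0) =
        if A ⊆ B then
          (((if ((M.filter fun e => cutCount A e ≠ 0).filter fun e => cutCount B e = 1).card ≤ c ∧
                ((M.filter fun e => cutCount A e ≠ 0).filter fun e => cutCount B e = 2).card ≤ i then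
            (M.card - (M.filter fun e => cutCount A e ≠ 0).card).choose
                (c - ((M.filter fun e => cutCount A e ≠ 0).filter fun e => cutCount B e = 1).card +
                  (i - ((M.filter fun e => cutCount A e ≠ 0).filter fun e => cutCount B e = 2).card)) *
              (c - ((M.filter fun e => cutCount A e ≠ 0).filter fun e => cutCount B e = 1).card +
                (i - ((M.filter fun e => cutCount A e ≠ 0).filter fun e => cutCount B e = 2).card)).choose
                  (i - ((M.filter fun e => cutCount A e ≠ 0).filter fun e => cutCount B e = 2).card) *
              2 ^ (c - ((M.filter fun e => cutCount A e ≠ 0).filter fun e => cutCount B e = 1).card)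
            else 0 : ℕ)) : ℝ)
        else 0 := by
      intro B hB
      have hconst : ∀ U ∈ (S.powerset.filter fun U => (M.filter fun e => cutCount U e = 1).card = c ∧
          (M.filter fun e => cutCount U e = 2).card = i).filter
          (fun U => U ∩ (S.filter fun v => ∃ e ∈ M.filter (fun e => cutCount A e ≠ 0), v ∈ e) = B),
          (if A ⊆ U then (1 : ℝ) else 0) = if A ⊆ B then (1 : ℝ) else 0 := by
        intro U hU
        have hUW := (mem_filter.1 hU).2
        have hiff : A ⊆ U ↔ A ⊆ B := by
          rw [← hUW]
          exact ⟨fun h => subset_inter h hAW, fun h => h.trans inter_subset_left⟩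
        by_cases hAB : A ⊆ B
        · rw [if_pos hAB, if_pos (hiff.2 hAB)]
        · rw [if_neg hAB, if_neg (fun h => hAB (hiff.1 h))]
      rw [sum_congr rfl hconst, sum_const, nsmul_eq_mul, filter_filter]
      have hfibB := card_fiber_eq hM hEM (mem_powerset.1 hB) c i
      have hset : (S.powerset.filter fun U => ((M.filter fun e => cutCount U e = 1).card = c ∧
            (M.filter fun e => cutCount U e = 2).card = i) ∧
            U ∩ (S.filter fun v => ∃ e ∈ M.filter (fun e => cutCount A e ≠ 0), v ∈ e) = B) =
          S.powerset.filter fun U => (M.filter fun e => cutCount U e = 1).card = c ∧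
            (M.filter fun e => cutCount U e = 2).card = i ∧
            U ∩ (S.filter fun v => ∃ e ∈ M.filter (fun e => cutCount A e ≠ 0), v ∈ e) = B :=
        filter_congr fun U _ => and_assoc
      rw [hset, hfibB]
      by_cases hAB : A ⊆ B
      · rw [if_pos hAB, if_pos hAB, mul_one]
      · rw [if_neg hAB, if_neg hAB, mul_zero]
    rw [sum_congr rfl hfib, ← sum_filter, eval_mul, eval_C]
    -- each fibre by the ratio identity
    have hratio : ∀ B ∈ (S.filter fun v => ∃ e ∈ M.filter (fun e => cutCount A e ≠ 0), v ∈ e).powerset.filter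
        (fun B => A ⊆ B),
        (((if ((M.filter fun e => cutCount A e ≠ 0).filter fun e => cutCount B e = 1).card ≤ c ∧
                ((M.filter fun e => cutCount A e ≠ 0).filter fun e => cutCount B e = 2).card ≤ i then
            (M.card - (M.filter fun e => cutCount A e ≠ 0).card).choose
                (c - ((M.filter fun e => cutCount A e ≠ 0).filter fun e => cutCount B e = 1).card +
                  (i - ((M.filter fun e => cutCount A e ≠ 0).filter fun e => cutCount B e = 2).card)) *
              (c - ((M.filter fun e => cutCount A e ≠ 0).filter fun e => cutCount B e = 1).card +
                (i - ((M.filter fun e => cutCount A e ≠ 0).filter fun e => cutCount B e = 2).card)).choose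
                  (i - ((M.filter fun e => cutCount A e ≠ 0).filter fun e => cutCount B e = 2).card) *
              2 ^ (c - ((M.filter fun e => cutCount A e ≠ 0).filter fun e => cutCount B e = 1).card)
            else 0 : ℕ)) : ℝ) =
          ((M.card.choose (c + i) * (c + i).choose i * 2 ^ c : ℕ) : ℝ) *
            (((M.card.descFactorial (M.filter fun e => cutCount A e ≠ 0).card : ℝ)⁻¹) *
              ((1 / 2 : ℝ) ^ ((M.filter fun e => cutCount A e ≠ 0).filter fun e => cutCount B e = 1).card *
                ((∏ j ∈ range ((M.filter fun e => cutCount A e ≠ 0).filter fun e => cutCount B e = 1).card,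
                    ((c : ℝ) - j)) *
                  ∏ j ∈ range ((M.filter fun e => cutCount A e ≠ 0).filter fun e => cutCount B e = 2).card,
                    ((i : ℝ) - j)))) := by
      intro B hB
      rw [mem_filter, mem_powerset] at hB
      rw [fibre_ratio hxN (card_cr_add_card_in_window (M := M) hB.2) c i, one_div, inv_pow]
      have h2 : (2 : ℝ) ^ ((M.filter fun e => cutCount A e ≠ 0).filter fun e => cutCount B e = 1).card ≠ 0 :=
        pow_ne_zero _ two_ne_zero
      have hN : (M.card.descFactorial (M.filter fun e => cutCount A e ≠ 0).card : ℝ) ≠ 0 := by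
        have : M.card.descFactorial (M.filter fun e => cutCount A e ≠ 0).card ≠ 0 := fun h0 => by
          rw [Nat.descFactorial_eq_zero_iff_lt] at h0; omega
        exact_mod_cast this
      field_simp
    rw [sum_congr rfl hratio, ← mul_sum, ← mul_sum,
      sum_traces_eq_sum_placements hM hA
        (fun y z => (∏ j ∈ range y, ((c : ℝ) - j)) * ∏ j ∈ range z, ((i : ℝ) - j)),
      eval_finsetSum]
    congr 2
    refine sum_congr rfl fun Q _ => ?_
    have hti : ∀ j : ℕ, (C ((t : ℝ) / 2 - ((j : ℕ) : ℝ)) - C (1 / 2 : ℝ) * X).eval (c : ℝ) = (i : ℝ) - j := by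
      intro j
      have : (t : ℝ) = c + 2 * i := by exact_mod_cast hci.symm
      simp only [eval_sub, eval_mul, eval_C, eval_X, this]
      ring
    rw [eval_mul, eval_C, eval_mul, eval_prod, eval_prod]
    simp only [eval_sub, eval_X, eval_C, hti]

/-- The half-degree lemma without the hypothesis `A ⊆ S` (for `A ⊄ S` every level sum vanishes and `P = 0`).
[folklore] -/
theorem half_degree_monomial' {S : Finset V} {M : Finset (Sym2 V)} (hM : IsPMOn S M) (A : Finset V) (t : ℕ) :
    ∃ P : Polynomial ℝ, P.natDegree ≤ A.card / 2 ∧ ∀ c i : ℕ, c + 2 * i = t →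
      ∑ U ∈ S.powerset.filter (fun U => (M.filter fun e => cutCount U e = 1).card = c ∧
          (M.filter fun e => cutCount U e = 2).card = i), (if A ⊆ U then (1 : ℝ) else 0) =
        ((M.card.choose (c + i) * (c + i).choose i * 2 ^ c : ℕ) : ℝ) * P.eval (c : ℝ) := by
  by_cases hA : A ⊆ S
  · exact half_degree_monomial hM hA t
  · refine ⟨0, by simp, fun c i _ => ?_⟩
    rw [eval_zero, mul_zero]
    refine sum_eq_zero fun U hU => if_neg fun hAU => hA (hAU.trans ?_)
    exact mem_powerset.1 (mem_filter.1 hU).1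

/-- **Half-degree lemma for functions of bounded x-degree** (the form used by the (L2) tail estimate of the
r = 1 rung, HOME/pnp-psdrank-p1/N2-SpreadStructure.md LINE CPD): if `f(U) = Σ_{A ⊆ S, |A| ≤ K} α_A · 1[A ⊆ U]`
is a combination of monomials of x-degree `≤ K`, then against every perfect matching `M` of `S` the level sums
`Σ_{U : #cr = c, #in = i} f(U)` along `c + 2i = t` equal `T(|M|;c,i) · P(c)` for one real polynomial `P` with
`natDegree P ≤ K/2` — so `c ↦ E[f(U) | |U| = t, cc(U,M) = c]` is a polynomial of degree `≤ ⌊K/2⌋`, and an exact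
design of degree `D` prices `p(c)·E[f | c]` at the virtual level whenever `deg p + K/2 ≤ D`. [folklore] -/
theorem half_degree {S : Finset V} {M : Finset (Sym2 V)} (hM : IsPMOn S M) (K t : ℕ) (α : Finset V → ℝ) :
    ∃ P : Polynomial ℝ, P.natDegree ≤ K / 2 ∧ ∀ c i : ℕ, c + 2 * i = t →
      ∑ U ∈ S.powerset.filter (fun U => (M.filter fun e => cutCount U e = 1).card = c ∧
          (M.filter fun e => cutCount U e = 2).card = i),
          ∑ A ∈ S.powerset.filter (fun A => A.card ≤ K), α A * (if A ⊆ U then (1 : ℝ) else 0) =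
        ((M.card.choose (c + i) * (c + i).choose i * 2 ^ c : ℕ) : ℝ) * P.eval (c : ℝ) := by
  classical
  choose P hPdeg hPval using fun A => half_degree_monomial' hM A t
  refine ⟨∑ A ∈ S.powerset.filter (fun A => A.card ≤ K), C (α A) * P A, ?_, ?_⟩
  · refine natDegree_sum_le_of_forall_le _ _ fun A hA => (natDegree_C_mul_le _ _).trans ((hPdeg A).trans ?_)
    exact Nat.div_le_div_right (mem_filter.1 hA).2
  · intro c i hci
    rw [sum_comm, eval_finsetSum, mul_sum]
    refine sum_congr rfl fun A _ => ?_
    rw [← mul_sum, hPval A c i hci, eval_mul, eval_C]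
    ring

end HalfDegree

end Summit.PneNP.PneNP.Theorems.ChebyshevTracialDesignHalfDegree
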